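import Summits.BirchSwinnertonDyer.BirchSwinnertonDyer.Theses.PrintX10b
import HarnessLib

/-!
# Route PrintX10b — the Assembly item (stmt-BirchSwinnertonDyer-20685), PROVED

Cell `bsd-print-x9` (D-0131 (2) PRINT tier, key `x9`, leaves ClassX9 + ClassX10b), seat `bsd-print-x9-p1`
(prover p1, gen 2). The route's assembly `Assembly := AnalyticMuZeroX10b → SchneiderX10bRankOne →
PrintFactsX10b → X10.BSDpOnClassX10b` is the tree's kernel theorem
`Summit.BirchSwinnertonDyer.Rank1Residual.X10.bsdpOnClassX10b_of_fine_of_mazur`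
(`Rank1Residual/X10/CoreTheoremAOddPrimeHolds.lean`) read on the route's items: destructure the print bundle
`PrintFactsX10b = hYZ ∧ hM ∧ hS ∧ hPR ∧ hmodP ∧ hGZK ∧ hfine` and apply. Candidate proof: the cell referee's
evidence `ProofX10bAssembly.lean` on the item (referee g2, 2026-08-27T15:52Z; the referee does not land
positives), independently the cell's lit seat (STATUS 15:55:44Z). HONEST STATUS: this closes the
ASSEMBLY item only — the leaf `X10.BSDpOnClassX10b` stays conditional on the two cruxes
`AnalyticMuZeroX10b` (20682, Greenberg's analytic μ = 0 at 3 on the class) and `SchneiderX10bRankOne`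
(20683, declared residual) and on the print bundle (whose conjunct `hfine` = Kato's fine-quotient package F1
carries the registry flag E114 and `hYZ` the flag `YZ26@3-BF-ERL-Ohta`); BSD is not proved here.
-/

namespace Summit.BirchSwinnertonDyer.Rank1Residual.X10

/-- **Assembly of route PrintX10b** (item stmt-BirchSwinnertonDyer-20685): Greenberg's analytic `μ = 0` at
`3` on class X10b, Schneider's non-degeneracy on its rank-`1` members and the print bundle
`PrintFactsX10b` (Yan–Zhu 2026 Thm 4.9 rational main conjecture at `p ≥ 3`; Mazur 1978 odd Manin constant;
Schneider 1985 / Perrin-Riou at odd `p`; modularity; GZK; Kato's fine-quotient zeta package) give `BSD_3` on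
the whole leaf `X10.BSDpOnClassX10b`, by the kernel theorem `X10.bsdpOnClassX10b_of_fine_of_mazur`.
[cite: Kato2004Asterisque, Thm. 12.6 (p. 222) and §17.13 (pp. 279–280)]
[cite: YanZhu2024MainConjNonCM, Thm. 4.9 (§4.4)] [cite: GreenbergLNM1716, Thm. 4.1 (p. 102) and §1 Conj. 1.11]
[cite: Mazur1978, Cor. 4.1] -/
theorem printX10b_assembly_proof :
    Summit.BirchSwinnertonDyer.BirchSwinnertonDyer.Theses.PrintX10b.Assembly := by
  intro hA hC3 hP
  obtain ⟨hYZ, hM, hS, hPR, hmodP, hGZK, hfine⟩ := hP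
  exact bsdpOnClassX10b_of_fine_of_mazur hYZ hM hS hPR hmodP hGZK hfine hA hC3

end Summit.BirchSwinnertonDyer.Rank1Residual.X10
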